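import Summits.AtomisticToContinuum.Crystallization.Theorems.FreeSplittingCertificatesStrictSplittingRuleP1FarCellTail
import Mathlib.MeasureTheory.Constructions.HaarToSphere
import Mathlib.MeasureTheory.Measure.Lebesgue.VolumeOfBalls
import Mathlib.MeasureTheory.Integral.IntegralEqImproper

/-!
# `StrictSplittingRule` (stmt-AtomisticToContinuum-12560): the LATTICE TAIL SUM `Σ_{‖y_q − y_p‖ ≥ 44a} ‖y_q − y_p‖⁻⁶` against the CONTINUUM — cube tiling + polar coordinates (P1 interpolant object, part 91)

Route `FreeSplittingCertificates`, crux r3 `StrictSplittingRule` (H12⋆ = `stub_coreJointCoercive`), unit b2b-freesplit-B gen 39.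
VALUE = the analytic brick of the (PAY) TAIL LEMMA (part 92): hypothesis (PAY) of `coreJointCoercive_cell_of_certificates₁₀`
(part 90) is a family of INFINITE lattice column sums `Σ'_q p1RecTable … (q − p) s ≤ p1Paym p s`; part 92 bounds the sum over the
sites OUTSIDE the `44a` site box of part 90 in the kernel, so that (PAY) becomes a FINITE statement.  The lattice sum it ends in is
bounded here SHARPLY (constant `4π/(3V_site)·(1 + O(a/R))`, versus the packing constant `250 (min a h)⁻³` of `…LatticeTailSums`, which
would force a `≈ 130a` box at the certificate's `0.7 %` slack):
* `hcpQ_le_of_abs_le_one`, `hcpSite_norm_sq_le_of_small`, `fpSq_corner_sub_corner_le` — corners of one cube of the chart are within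
  `√(16a²/3 + h²) ≤ 5a/2` of each other; `fpSq_sub_corner_le_of_mem_cell` — hence so is every point of a cell from every corner of
  its cube (Jensen on the barycentric representation, as in part 80);
* `payTailProfile`, `payTailF` — the radial majorant `F(y) = [83a/2 ≤ |y − y_p|]·(|y − y_p| − 5a/2)⁻⁶`; `integral_payTailF` — its
  integral `4π·((39a)⁻³/3 + (5a/4)(39a)⁻⁴ + (5a²/4)(39a)⁻⁵)` by Mathlib's polar-coordinate formula `integral_fun_norm_addHaar`,
  `vol B₁(ℝ³) = 4π/3` and the fundamental theorem of calculus on `[83a/2, ∞)`;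
* **`hcpSite_tsum_far44_inv_pow_six_le`**: `Σ'_{q : ‖y_q − y_p‖ ≥ 44a} ‖y_q − y_p‖⁻⁶ ≤ (2/(√3a²h))·∫F` — each far site's term is
  at most `(1/V)∫_{cube q} F` over the six cells of its cube (`V = 6·√3a²h/12`, every point within `5a/2` of `y_q`), and the cells
  are a.e. disjoint (`p1RealCell_aedisjoint`).
NOT a proof of H12⋆, NOT summit progress.  [folklore]
-/

noncomputable section

open Set Function Metric MeasureTheory Filter Topology
open scoped BigOperators NNReal ENNReal Classical

namespace Summit.AtomisticToContinuum.Crystallization.Theorems.StrictSplittingRuleBirth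

open Literature.MathematicalPhysics.StatisticalMechanics
open Summit.AtomisticToContinuum.Crystallization.Theorems.PalmUnimodularRigidity.LayeredLawsSelectHcp

/-! ## Corners of a cube are close to each other and to every point of its cells -/

/-- The index form on small offsets: `Q(v) ≤ 16/3` whenever `|i|, |j| ≤ 1`. -/
theorem hcpQ_le_of_abs_le_one (v : ℤ × ℤ × ℤ) (hi : |v.2.1| ≤ 1) (hj : |v.2.2| ≤ 1) : hcpQ v ≤ 16 / 3 := by
  have hi' : |(v.2.1 : ℝ)| ≤ 1 := by exact_mod_cast hi
  have hj' : |(v.2.2 : ℝ)| ≤ 1 := by exact_mod_cast hj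
  rw [abs_le] at hi' hj'
  have h1 : (v.2.1 : ℝ) ^ 2 ≤ 1 := by nlinarith
  have h2 : (v.2.2 : ℝ) ^ 2 ≤ 1 := by nlinarith
  have h3 : (v.2.1 : ℝ) * v.2.2 ≤ 1 := by nlinarith
  unfold hcpQ
  split_ifs <;> linarith

/-- `‖y_v‖² ≤ 16a²/3 + h²` for every index `v ∈ {−1,0,1}³`. -/
theorem hcpSite_norm_sq_le_of_small (a h : ℝ) (v : ℤ × ℤ × ℤ) (hk : |v.1| ≤ 1) (hi : |v.2.1| ≤ 1) (hj : |v.2.2| ≤ 1) :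
    ‖hcpSite a h v‖ ^ 2 ≤ 16 * a ^ 2 / 3 + h ^ 2 := by
  rw [hcpSite_norm_sq]
  have hQ := mul_le_mul_of_nonneg_left (hcpQ_le_of_abs_le_one v hi hj) (sq_nonneg a)
  have hk' : (v.1 : ℝ) ^ 2 ≤ 1 := by
    have : |(v.1 : ℝ)| ≤ 1 := by exact_mod_cast hk
    rw [abs_le] at this
    nlinarith
  have hk2 := mul_le_mul_of_nonneg_right hk' (sq_nonneg h)
  linarith

/-- **Corners of one cube are close**: `|y_{n+o'} − y_{n+o}|² ≤ 16a²/3 + h²` for `o, o' ∈ {0,1}³` (Bravais covariance `h1_sub_eq`: the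
difference is `±y_{±(o'−o)}` with `o' − o ∈ {−1,0,1}³`). -/
theorem fpSq_corner_sub_corner_le (a h : ℝ) (n : ℤ × ℤ × ℤ) {o o' : ℤ × ℤ × ℤ} (ho : o ∈ p1Corners) (ho' : o' ∈ p1Corners) :
    fpSq (fun k => hcpSite a h (n + o') k - hcpSite a h (n + o) k) ≤ 16 * a ^ 2 / 3 + h ^ 2 := by
  obtain ⟨h1, h2, h3⟩ := (mem_p1Corners_iff o).1 ho
  obtain ⟨h1', h2', h3'⟩ := (mem_p1Corners_iff o').1 ho'
  have e : (fun k => hcpSite a h (n + o') k - hcpSite a h (n + o) k) =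
      fun k => (hcpSite a h ((n + o) + (o' - o)) - hcpSite a h (n + o)) k := by
    funext k
    rw [PiLp.sub_apply, show n + o + (o' - o) = n + o' by abel]
  rw [e, h1_sub_eq a h (n + o) (o' - o)]
  split_ifs with hev
  · rw [fpSq_coe_eq_norm_sq]
    refine hcpSite_norm_sq_le_of_small a h _ (abs_le.2 ⟨?_, ?_⟩) (abs_le.2 ⟨?_, ?_⟩) (abs_le.2 ⟨?_, ?_⟩) <;>
      simp only [Prod.fst_sub, Prod.snd_sub] <;> omega
  · have hneg : fpSq (fun k => (-hcpSite a h (-(o' - o))) k) = fpSq (fun k => (hcpSite a h (-(o' - o))) k) := by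
      simp [fpSq]
    rw [hneg, fpSq_coe_eq_norm_sq]
    refine hcpSite_norm_sq_le_of_small a h _ (abs_le.2 ⟨?_, ?_⟩) (abs_le.2 ⟨?_, ?_⟩) (abs_le.2 ⟨?_, ?_⟩) <;>
      simp only [Prod.fst_neg, Prod.snd_neg, Prod.fst_sub, Prod.snd_sub] <;> omega

/-- **Every point of a cell is within `√(16a²/3 + h²)` of every corner of its cube**: for `y ∈ p1RealCell (n, π)` and `o ∈ {0,1}³`,
`|y − y_{n+o}|² ≤ 16a²/3 + h²` (Jensen on the barycentric representation `y − y_{n+o} = Σ_m λ_m(y)(y_m − y_{n+o})`; the vertices are corners). -/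
theorem fpSq_sub_corner_le_of_mem_cell {a h : ℝ} (ha : a ≠ 0) (hh : h ≠ 0) {n : ℤ × ℤ × ℤ} {π : Fin 6} {o : ℤ × ℤ × ℤ}
    (ho : o ∈ p1Corners) {y : Fin 3 → ℝ} (hy : y ∈ p1RealCell a h (n, π)) :
    fpSq (fun k => y k - hcpSite a h (n + o) k) ≤ 16 * a ^ 2 / 3 + h ^ 2 := by
  set i : (ℤ × ℤ × ℤ) × Fin 6 := (n, π) with hi
  set e : Fin 4 → Fin 3 → ℝ := fun m' k => hcpSite a h (i.1 + p1VertOff (p1Par i.1) i.2 m') k - hcpSite a h (n + o) k with he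
  have hrep : ∀ k, y k - hcpSite a h (n + o) k = ∑ m' : Fin 4, p1Lam a h i m' y * e m' k := by
    intro k
    have h1 := sum_p1Lam_eq_one a h i y
    have h2 := sum_p1Lam_mul_hcpSite ha hh hy k
    simp only [he, mul_sub, Finset.sum_sub_distrib, ← Finset.sum_mul, h1, h2, one_mul]
  have hj := p1_jensen_sq (fun m' => p1Lam a h i m' y) (fun m' => p1Lam_nonneg_of_mem hy m') (sum_p1Lam_eq_one a h i y) e
  have hv' : ∀ m', e m' 0 ^ 2 + e m' 1 ^ 2 + e m' 2 ^ 2 ≤ 16 * a ^ 2 / 3 + h ^ 2 := fun m' =>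
    fpSq_corner_sub_corner_le a h n ho (p1VertOff_mem_p1Corners (p1Par n) π m')
  calc fpSq (fun k => y k - hcpSite a h (n + o) k)
      = (∑ m', p1Lam a h i m' y * e m' 0) ^ 2 + (∑ m', p1Lam a h i m' y * e m' 1) ^ 2 + (∑ m', p1Lam a h i m' y * e m' 2) ^ 2 := by
        simp only [fpSq, hrep]
    _ ≤ ∑ m', p1Lam a h i m' y * (e m' 0 ^ 2 + e m' 1 ^ 2 + e m' 2 ^ 2) := hj
    _ ≤ ∑ m', p1Lam a h i m' y * (16 * a ^ 2 / 3 + h ^ 2) :=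
        Finset.sum_le_sum fun m' _ => mul_le_mul_of_nonneg_left (hv' m') (p1Lam_nonneg_of_mem hy m')
    _ = 16 * a ^ 2 / 3 + h ^ 2 := by rw [← Finset.sum_mul, sum_p1Lam_eq_one, one_mul]

/-- On the hcp ratio box the corner radius is at most `5a/2`: `16a²/3 + h² ≤ (5a/2)²`. -/
theorem cornerRad_sq_le {a h : ℝ} (hh : 0 ≤ h) (hhi : h ≤ 81657 / 100000 * a) : 16 * a ^ 2 / 3 + h ^ 2 ≤ (5 / 2 * a) ^ 2 := by
  nlinarith [mul_self_le_mul_self hh hhi]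


/-! ## The radial tail majorant and its integral -/

/-- The radial tail profile `f(t) = [83a/2 ≤ t]·((t − 5a/2)⁶)⁻¹`. -/
def payTailProfile (a t : ℝ) : ℝ := if 83 / 2 * a ≤ t then ((t - 5 / 2 * a) ^ 6)⁻¹ else 0

/-- The tail majorant on `ℝ³` centred at `c`: `F(y) = f(√|y − c|²)`. -/
def payTailF (a : ℝ) (c : Fin 3 → ℝ) (y : Fin 3 → ℝ) : ℝ := payTailProfile a (√(fpSq (y - c)))

/-- The profile is nonnegative. -/
theorem payTailProfile_nonneg (a t : ℝ) : 0 ≤ payTailProfile a t := by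
  unfold payTailProfile; split_ifs <;> positivity

/-- The majorant is nonnegative. -/
theorem payTailF_nonneg (a : ℝ) (c y : Fin 3 → ℝ) : 0 ≤ payTailF a c y := payTailProfile_nonneg _ _

/-- The antiderivative of `t²(t − c)⁻⁶`: `Φ(t) = −(t−c)⁻³/3 − (c/2)(t−c)⁻⁴ − (c²/5)(t−c)⁻⁵`. -/
def payTailPrim (c t : ℝ) : ℝ := -((t - c) ^ 3)⁻¹ / 3 - c / 2 * ((t - c) ^ 4)⁻¹ - c ^ 2 / 5 * ((t - c) ^ 5)⁻¹

/-- `Φ′(t) = t²(t − c)⁻⁶` for `t > c`. -/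
theorem hasDerivAt_payTailPrim {c t : ℝ} (ht : c < t) : HasDerivAt (payTailPrim c) (t ^ 2 * ((t - c) ^ 6)⁻¹) t := by
  have hx : t - c ≠ 0 := sub_ne_zero.2 (ne_of_gt ht)
  have hs : HasDerivAt (fun t => t - c) 1 t := (hasDerivAt_id t).sub_const c
  have h3 := (hs.fun_pow 3).fun_inv (pow_ne_zero 3 hx)
  have h4 := (hs.fun_pow 4).fun_inv (pow_ne_zero 4 hx)
  have h5 := (hs.fun_pow 5).fun_inv (pow_ne_zero 5 hx)
  have hΦ := ((h3.neg.div_const 3).fun_sub (h4.const_mul (c / 2))).fun_sub (h5.const_mul (c ^ 2 / 5))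
  refine hΦ.congr_deriv ?_
  push_cast
  field_simp
  ring

/-- `Φ(t) → 0` as `t → ∞`. -/
theorem tendsto_payTailPrim (c : ℝ) : Tendsto (payTailPrim c) atTop (𝓝 0) := by
  have hs : Tendsto (fun t : ℝ => t - c) atTop atTop := by
    simpa [sub_eq_add_neg] using tendsto_atTop_add_const_right atTop (-c) tendsto_id
  have hp : ∀ n : ℕ, n ≠ 0 → Tendsto (fun t : ℝ => ((t - c) ^ n)⁻¹) atTop (𝓝 0) := fun n hn =>
    tendsto_inv_atTop_zero.comp ((tendsto_pow_atTop hn).comp hs)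
  have h := (((hp 3 (by norm_num)).neg.div_const 3).sub ((hp 4 (by norm_num)).const_mul (c / 2))).sub
    ((hp 5 (by norm_num)).const_mul (c ^ 2 / 5))
  simp only [neg_zero, zero_div, mul_zero, sub_zero] at h
  exact h

/-- **The radial integral**: `∫_{83a/2}^∞ t²(t − 5a/2)⁻⁶ dt = (39a)⁻³/3 + (5a/4)(39a)⁻⁴ + (5a²/4)(39a)⁻⁵`. -/
theorem integral_Ioi_sq_mul_inv_pow_six {a : ℝ} (ha : 0 < a) :
    ∫ t in Ioi (83 / 2 * a), t ^ 2 * ((t - 5 / 2 * a) ^ 6)⁻¹ =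
      ((39 * a) ^ 3)⁻¹ / 3 + 5 / 4 * a * ((39 * a) ^ 4)⁻¹ + 5 / 4 * a ^ 2 * ((39 * a) ^ 5)⁻¹ := by
  have hca : 5 / 2 * a < 83 / 2 * a := by linarith
  rw [integral_Ioi_of_hasDerivAt_of_nonneg' (g := payTailPrim (5 / 2 * a)) (l := 0)
      (fun t ht => hasDerivAt_payTailPrim (lt_of_lt_of_le hca ht)) (fun t _ => by positivity) (tendsto_payTailPrim _)]
  simp only [payTailPrim]
  rw [show 83 / 2 * a - 5 / 2 * a = 39 * a by ring]
  ring

/-- The radial integrand is integrable on `(83a/2, ∞)`. -/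
theorem integrableOn_Ioi_sq_mul_inv_pow_six {a : ℝ} (ha : 0 < a) :
    IntegrableOn (fun t : ℝ => t ^ 2 * ((t - 5 / 2 * a) ^ 6)⁻¹) (Ioi (83 / 2 * a)) := by
  have hca : 5 / 2 * a < 83 / 2 * a := by linarith
  exact integrableOn_Ioi_deriv_of_nonneg' (g := payTailPrim (5 / 2 * a)) (l := 0)
    (fun t ht => hasDerivAt_payTailPrim (lt_of_lt_of_le hca ht)) (fun t _ => by positivity) (tendsto_payTailPrim _)

/-- The weighted profile is the indicator of the radial integrand. -/
theorem sq_smul_payTailProfile_eq_indicator (a : ℝ) :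
    (fun y : ℝ => y ^ (3 - 1) • payTailProfile a y) = (Ici (83 / 2 * a)).indicator (fun t => t ^ 2 * ((t - 5 / 2 * a) ^ 6)⁻¹) := by
  funext y
  simp only [payTailProfile, smul_eq_mul, Set.indicator_apply, mem_Ici]
  split_ifs <;> simp

/-- `vol(B₁(ℝ³)) = 4π/3`. [folklore] -/
theorem volume_real_ball_E3 : (volume : Measure (EuclideanSpace ℝ (Fin 3))).real (ball 0 1) = 4 * Real.pi / 3 := by
  rw [measureReal_def, EuclideanSpace.volume_ball_fin_three]
  simp only [ENNReal.ofReal_one, one_pow, one_mul]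
  rw [ENNReal.toReal_ofReal (by positivity)]
  ring

/-- The radial function `x ↦ f(‖x‖)` is integrable on `ℝ³`. -/
theorem integrable_payTailProfile_norm {a : ℝ} (ha : 0 < a) :
    Integrable (fun x : EuclideanSpace ℝ (Fin 3) => payTailProfile a ‖x‖) := by
  rw [integrable_fun_norm_addHaar volume (f := payTailProfile a), finrank_euclideanSpace_fin,
    sq_smul_payTailProfile_eq_indicator a]
  have hA : 0 < 83 / 2 * a := by positivity
  have h1 : IntegrableOn (fun t : ℝ => t ^ 2 * ((t - 5 / 2 * a) ^ 6)⁻¹) (Ici (83 / 2 * a)) :=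
    (integrableOn_Ioi_sq_mul_inv_pow_six ha).congr_set_ae Ioi_ae_eq_Ici.symm
  exact (h1.integrable_indicator measurableSet_Ici).integrableOn

/-- Transport of the majorant to `EuclideanSpace`: `F(e⁻¹x) = f(‖x − e c‖)`. -/
theorem payTailF_toLp_symm (a : ℝ) (c : Fin 3 → ℝ) (x : EuclideanSpace ℝ (Fin 3)) :
    payTailF a c ((MeasurableEquiv.toLp 2 (Fin 3 → ℝ)).symm x) =
      payTailProfile a ‖x - (MeasurableEquiv.toLp 2 (Fin 3 → ℝ)) c‖ := by
  have hsq : fpSq ((MeasurableEquiv.toLp 2 (Fin 3 → ℝ)).symm x - c) = ‖x - (MeasurableEquiv.toLp 2 (Fin 3 → ℝ)) c‖ ^ 2 := by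
    rw [← fpSq_coe_eq_norm_sq]
    congr 1
  unfold payTailF
  rw [hsq, Real.sqrt_sq (norm_nonneg _)]

/-- **The majorant is integrable on `ℝ³`.** -/
theorem integrable_payTailF {a : ℝ} (ha : 0 < a) (c : Fin 3 → ℝ) : Integrable (payTailF a c) := by
  set e := MeasurableEquiv.toLp 2 (Fin 3 → ℝ) with he_def
  have hG : Integrable (fun x : EuclideanSpace ℝ (Fin 3) => payTailProfile a ‖x - e c‖) :=
    (integrable_payTailProfile_norm ha).comp_sub_right (e c)
  have hme : MeasurePreserving e volume volume := by
    have := (EuclideanSpace.volume_preserving_symm_measurableEquiv_toLp (Fin 3)).symm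
    simpa [he_def] using this
  have hF : payTailF a c = (fun x : EuclideanSpace ℝ (Fin 3) => payTailProfile a ‖x - e c‖) ∘ e := by
    funext y
    simp only [Function.comp_apply]
    rw [← payTailF_toLp_symm a c (e y), he_def, MeasurableEquiv.symm_apply_apply]
  rw [hF]
  exact (hme.integrable_comp_emb e.measurableEmbedding).2 hG

/-- **THE INTEGRAL OF THE MAJORANT** (polar coordinates in `ℝ³`, `vol B₁ = 4π/3`, the radial integral):
`∫ F = 4π·((39a)⁻³/3 + (5a/4)(39a)⁻⁴ + (5a²/4)(39a)⁻⁵)`. -/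
theorem integral_payTailF {a : ℝ} (ha : 0 < a) (c : Fin 3 → ℝ) :
    ∫ y, payTailF a c y =
      4 * Real.pi * (((39 * a) ^ 3)⁻¹ / 3 + 5 / 4 * a * ((39 * a) ^ 4)⁻¹ + 5 / 4 * a ^ 2 * ((39 * a) ^ 5)⁻¹) := by
  set e := MeasurableEquiv.toLp 2 (Fin 3 → ℝ) with he_def
  have h1 : ∫ y, payTailF a c y = ∫ x : EuclideanSpace ℝ (Fin 3), payTailF a c (e.symm x) :=
    ((EuclideanSpace.volume_preserving_symm_measurableEquiv_toLp (Fin 3)).integral_comp' (payTailF a c)).symm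
  have h2 : ∀ x : EuclideanSpace ℝ (Fin 3), payTailF a c (e.symm x) = payTailProfile a ‖x - e c‖ :=
    fun x => payTailF_toLp_symm a c x
  have h3 : ∫ x : EuclideanSpace ℝ (Fin 3), payTailProfile a ‖x - e c‖ = ∫ x : EuclideanSpace ℝ (Fin 3), payTailProfile a ‖x‖ :=
    integral_sub_right_eq_self (fun z : EuclideanSpace ℝ (Fin 3) => payTailProfile a ‖z‖) (e c)
  rw [h1]
  simp_rw [h2]
  rw [h3, integral_fun_norm_addHaar volume (payTailProfile a), finrank_euclideanSpace_fin, volume_real_ball_E3,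
    sq_smul_payTailProfile_eq_indicator a, integral_indicator measurableSet_Ici, Measure.restrict_restrict measurableSet_Ici,
    show Ici (83 / 2 * a) ∩ Ioi (0 : ℝ) = Ici (83 / 2 * a) from inter_eq_left.2 fun t ht => lt_of_lt_of_le (by positivity : (0 : ℝ) < 83 / 2 * a) ht,
    integral_Ici_eq_integral_Ioi, integral_Ioi_sq_mul_inv_pow_six ha]
  simp only [nsmul_eq_mul, smul_eq_mul]
  push_cast
  ring


/-! ## The lattice tail sum against the continuum -/

/-- `(0,0,0)` is a corner. -/
theorem zero_mem_p1Corners : (0 : ℤ × ℤ × ℤ) ∈ p1Corners := by decide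

/-- **On a cell of the cube of a far site the majorant dominates the site's term**: for `‖y_q − y_p‖ = r ≥ 44a` and `y` in a cell of
cube `q`, `(r²)⁻³ ≤ F(y)` (every point of the cell is within `5a/2` of `y_q`, so `83a/2 ≤ |y − y_p|` and `|y − y_p| − 5a/2 ≤ r`). -/
theorem inv_pow_six_le_payTailF {a h : ℝ} (ha : 0 < a) (hh : 0 < h) (hhi : h ≤ 81657 / 100000 * a) (p q : ℤ × ℤ × ℤ)
    (hfar : 44 * a ≤ ‖hcpSite a h q - hcpSite a h p‖) {π : Fin 6} {y : Fin 3 → ℝ} (hy : y ∈ p1RealCell a h (q, π)) :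
    ((‖hcpSite a h q - hcpSite a h p‖ ^ 2)⁻¹) ^ 3 ≤ payTailF a (fun k => hcpSite a h p k) y := by
  set r := ‖hcpSite a h q - hcpSite a h p‖ with hr
  have hr0 : 0 ≤ r := norm_nonneg _
  set d : Fin 3 → ℝ := fun k => hcpSite a h q k - hcpSite a h p k with hd_def
  have hd : fpSq d = r ^ 2 := by rw [hr, norm_sq_eq_three]; simp [fpSq, hd_def]
  set u : Fin 3 → ℝ := fun k => y k - hcpSite a h q k with hu_def
  have hu : fpSq u ≤ (5 / 2 * a) ^ 2 := by
    have h1 := fpSq_sub_corner_le_of_mem_cell (o := 0) ha.ne' hh.ne' zero_mem_p1Corners hy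
    simp only [add_zero] at h1
    exact h1.trans (cornerRad_sq_le hh.le hhi)
  have hx : (y - fun k => hcpSite a h p k) = d + u := by
    funext k
    simp only [hd_def, hu_def, Pi.sub_apply, Pi.add_apply]
    ring
  have hρ : (0 : ℝ) ≤ 5 / 2 * a := by positivity
  have hρr : 5 / 2 * a ≤ r := by linarith
  have hlo := sq_le_fpSq_add hρ hρr hd hu
  have hup := fpSq_add_le_sq hr0 hρ hd hu
  unfold payTailF
  rw [hx]
  set s := √(fpSq (d + u)) with hs
  have hslo : r - 5 / 2 * a ≤ s := by
    rw [hs, ← Real.sqrt_sq (by linarith : 0 ≤ r - 5 / 2 * a)]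
    exact Real.sqrt_le_sqrt hlo
  have hsup : s ≤ r + 5 / 2 * a := by
    rw [hs, ← Real.sqrt_sq (by linarith : 0 ≤ r + 5 / 2 * a)]
    exact Real.sqrt_le_sqrt hup
  unfold payTailProfile
  rw [if_pos (by linarith)]
  have h1 : 0 < s - 5 / 2 * a := by linarith
  have h2 : s - 5 / 2 * a ≤ r := by linarith
  have h3 : (s - 5 / 2 * a) ^ 6 ≤ r ^ 6 := pow_le_pow_left₀ h1.le h2 6
  have h4 : 0 < (s - 5 / 2 * a) ^ 6 := by positivity
  calc ((r ^ 2)⁻¹) ^ 3 = (r ^ 6)⁻¹ := by rw [inv_pow, ← pow_mul]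
    _ ≤ ((s - 5 / 2 * a) ^ 6)⁻¹ := inv_anti₀ h4 h3

/-- **THE LATTICE TAIL SUM AGAINST THE CONTINUUM.**  On the hcp ratio box, for ANY base site `p`:
`Σ'_{q : ‖y_q − y_p‖ ≥ 44a} (‖y_q − y_p‖²)⁻³ ≤ (2/(√3a²h))·4π·((39a)⁻³/3 + (5a/4)(39a)⁻⁴ + (5a²/4)(39a)⁻⁵)` (with summability):
each far site's term times the cube volume `6·√3a²h/12` is at most the integral of the majorant `F` over the six cells of its cube
(`inv_pow_six_le_payTailF`), the cells are pairwise a.e. disjoint, and `∫F` is `integral_payTailF`.  (Sharp to `1 + O(a/R)`: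
the constant is `4π/(3V_site)`.)  NOT a proof of H12⋆, NOT summit progress. [folklore] -/
theorem hcpSite_tsum_far44_inv_pow_six_le {a h : ℝ} (ha : 0 < a) (hh : 0 < h) (hhi : h ≤ 81657 / 100000 * a) (p : ℤ × ℤ × ℤ) :
    Summable (fun q : ℤ × ℤ × ℤ =>
      if 44 * a ≤ ‖hcpSite a h q - hcpSite a h p‖ then ((‖hcpSite a h q - hcpSite a h p‖ ^ 2)⁻¹) ^ 3 else 0) ∧
    ∑' q : ℤ × ℤ × ℤ, (if 44 * a ≤ ‖hcpSite a h q - hcpSite a h p‖ then ((‖hcpSite a h q - hcpSite a h p‖ ^ 2)⁻¹) ^ 3 else 0) ≤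
      2 / (√3 * a ^ 2 * h) *
        (4 * Real.pi * (((39 * a) ^ 3)⁻¹ / 3 + 5 / 4 * a * ((39 * a) ^ 4)⁻¹ + 5 / 4 * a ^ 2 * ((39 * a) ^ 5)⁻¹)) := by
  set cp : Fin 3 → ℝ := fun k => hcpSite a h p k with hcp
  set F := payTailF a cp with hF
  set I : ℝ := 4 * Real.pi * (((39 * a) ^ 3)⁻¹ / 3 + 5 / 4 * a * ((39 * a) ^ 4)⁻¹ + 5 / 4 * a ^ 2 * ((39 * a) ^ 5)⁻¹) with hIdef
  set φ : ℤ × ℤ × ℤ → ℝ := fun q =>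
    if 44 * a ≤ ‖hcpSite a h q - hcpSite a h p‖ then ((‖hcpSite a h q - hcpSite a h p‖ ^ 2)⁻¹) ^ 3 else 0 with hφ
  have hφ0 : ∀ q, 0 ≤ φ q := fun q => by
    simp only [hφ]
    split_ifs <;> positivity
  have hFint : Integrable F := integrable_payTailF ha cp
  have hI : ∫ y, F y = I := integral_payTailF ha cp
  -- the cell decomposition of `∫F`
  have hsum : HasSum (fun i => ∫ y in p1RealCell a h i, F y) (∫ y, F y) := by
    have h1 := hasSum_integral_iUnion_ae (μ := volume) (f := F) (s := p1RealCell a h)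
      (fun i => (isClosed_p1RealCell a h i).measurableSet.nullMeasurableSet) (p1RealCell_aedisjoint ha.ne' hh.ne')
      (by rw [iUnion_p1RealCell]; exact hFint.integrableOn)
    rwa [iUnion_p1RealCell, setIntegral_univ] at h1
  have hcell0 : ∀ i, 0 ≤ ∫ y in p1RealCell a h i, F y := fun i => integral_nonneg fun y => payTailF_nonneg a cp y
  have hV : 0 < √3 * a ^ 2 * h / 12 := by positivity
  -- a far site's term against the integral over one cell of its cube
  have hcell : ∀ q, 44 * a ≤ ‖hcpSite a h q - hcpSite a h p‖ → ∀ π : Fin 6,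
      √3 * a ^ 2 * h / 12 * ((‖hcpSite a h q - hcpSite a h p‖ ^ 2)⁻¹) ^ 3 ≤ ∫ y in p1RealCell a h (q, π), F y := by
    intro q hq π
    have hmeas : MeasurableSet (p1RealCell a h (q, π)) := (isClosed_p1RealCell a h _).measurableSet
    have hvol := volume_p1RealCell ha hh (q, π)
    have hconst : IntegrableOn (fun _ : Fin 3 → ℝ => ((‖hcpSite a h q - hcpSite a h p‖ ^ 2)⁻¹) ^ 3)
        (p1RealCell a h (q, π)) volume := by
      refine integrableOn_const ?_
      rw [hvol]
      exact ENNReal.ofReal_ne_top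
    have hmono := setIntegral_mono_on hconst hFint.integrableOn hmeas
      fun y hy => inv_pow_six_le_payTailF ha hh hhi p q hq hy
    have hc : ∫ _ in p1RealCell a h (q, π), ((‖hcpSite a h q - hcpSite a h p‖ ^ 2)⁻¹) ^ 3 =
        √3 * a ^ 2 * h / 12 * ((‖hcpSite a h q - hcpSite a h p‖ ^ 2)⁻¹) ^ 3 := by
      rw [setIntegral_const, measureReal_def, hvol, ENNReal.toReal_ofReal hV.le, smul_eq_mul]
    rw [hc] at hmono
    exact hmono
  -- every site: `(√3a²h/2)·φ q ≤ Σ_π ∫_{cell (q,π)} F`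
  have hsite : ∀ q, √3 * a ^ 2 * h / 2 * φ q ≤ ∑ π : Fin 6, ∫ y in p1RealCell a h (q, π), F y := by
    intro q
    simp only [hφ]
    split_ifs with hq
    · calc √3 * a ^ 2 * h / 2 * ((‖hcpSite a h q - hcpSite a h p‖ ^ 2)⁻¹) ^ 3
          = ∑ _π : Fin 6, √3 * a ^ 2 * h / 12 * ((‖hcpSite a h q - hcpSite a h p‖ ^ 2)⁻¹) ^ 3 := by
            rw [Finset.sum_const, Finset.card_univ, Fintype.card_fin, nsmul_eq_mul]
            push_cast
            ring
        _ ≤ ∑ π : Fin 6, ∫ y in p1RealCell a h (q, π), F y := Finset.sum_le_sum fun π _ => hcell q hq π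
    · rw [mul_zero]
      exact Finset.sum_nonneg fun π _ => hcell0 (q, π)
  -- finite partial sums
  have hW : (√3 * a ^ 2 * h) ≠ 0 := by positivity
  have hfin : ∀ Qs : Finset (ℤ × ℤ × ℤ), ∑ q ∈ Qs, φ q ≤ 2 / (√3 * a ^ 2 * h) * I := by
    intro Qs
    have h1 : ∑ i ∈ Qs ×ˢ (Finset.univ : Finset (Fin 6)), ∫ y in p1RealCell a h i, F y ≤ ∫ y, F y :=
      sum_le_hasSum _ (fun i _ => hcell0 i) hsum
    rw [Finset.sum_product] at h1
    have h2 : √3 * a ^ 2 * h / 2 * ∑ q ∈ Qs, φ q ≤ I := by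
      rw [← hI, Finset.mul_sum]
      exact (Finset.sum_le_sum fun q _ => hsite q).trans h1
    calc ∑ q ∈ Qs, φ q = 2 / (√3 * a ^ 2 * h) * (√3 * a ^ 2 * h / 2 * ∑ q ∈ Qs, φ q) := by
          field_simp
      _ ≤ 2 / (√3 * a ^ 2 * h) * I := mul_le_mul_of_nonneg_left h2 (by positivity)
  exact ⟨summable_of_sum_le hφ0 hfin, Real.tsum_le_of_sum_le hφ0 hfin⟩

end Summit.AtomisticToContinuum.Crystallization.Theorems.StrictSplittingRuleBirth

end
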